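import Literature.IUT.HodgeTheaters.BadLocalFrobenioidOfKits
import HarnessLib

/-!
# [IUTchI] Example 3.2: NON-VACUITY of `BadLocalFrobenioid.ofKits` (KIT-RULE witness at a DEGENERATE tempered side)

Mochizuki, *Inter-universal Teichmüller Theory I*, kurims manuscript (May 2020), Example 3.2 pp. 69–73
[cite: Mochizuki2012, I Ex 3.2 pp.69-73] (D-0012 claim key, status disputed; nothing of the series is asserted).

`BadLocalFrobenioidOfKits.lean` assembles abc-iut-L5-t2's interface `BadLocalFrobenioid l K_v` from REAL pieces plus a
tempered-side INPUT `TemperedThetaInput`. THIS FILE shows the inputs are jointly inhabited — so the assembly FIRES — at a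
labelled DEGENERATE choice (witnessed ≠ endorsed; nothing here is a claim about the genuine tempered objects of [EtTh]):
* `BadLocalGroupDatum.trivial G` — "`Π_v := G_v`, `Ÿ_v := X̲̲_v`": `aug := id`, `Π_Ÿ := ⊤` (then `Ÿ_v × A = A`, and the
  second projection `Ÿ_v × A → A` is an ISOMORPHISM: `prodSndIso`; `prodForgetIso : (A ↦ Ÿ_v × A) ⋙ forget ≅ incl`);
* `TemperedThetaInput.trivial` — "`F̲_v := F÷_v := C_v := C^Θ_v`": the tempered Frobenioid, its birationalization and its
  base-field hull all modelled by the REAL `p_v`-adic Frobenioid `C^Θ_v` over `D^Θ_v` (`T_A := (A^Θ, 0)`,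
  `𝒪^×(T^÷_Ÿ) := 1 ∋ Θ̲_v := 1`, `l·ℤ := 1`, constants trivial, `C⊢_v → C_v := dashThetaEquiv`, `C^Θ_v ⊆ F÷_v := 𝟭`);
* `BadLocalFrobenioid.ofKitsPadic p l : BadLocalFrobenioid l ℚ_p` — at `K_v := ℚ_p` with `Ω := ℚ̄_p`
  (`GaloisValDatum.ofPadic`, every valuation-theoretic input DISCHARGED), `q̲_v := p`, `q_v := p^{2l}`: an inhabitant of
  the interface whose bases are the REAL coset categories of `Gal(ℚ̄_p/ℚ_p)` and whose `C⊢_v ⥲ C^Θ_v` are REAL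
  [FrdII] Frobenioids — for EVERY prime `p` and EVERY `l`.
-/

noncomputable section

namespace Literature.IUT.HodgeTheaters

open CategoryTheory Opposite Literature.AnabelianGeometry.SemiGraphs Literature.AlgebraicGeometry.Frobenioids
open Literature.AlgebraicGeometry.Frobenioids.PadicFrd

universe u

/-! ### The degenerate group datum `Π_v := G_v`, `Π_Ÿ := G_v` -/

namespace BadLocalGroupDatum

variable (G : Type u) [Group G] [TopologicalSpace G]

/-- **DEGENERATE group datum** (labelled toy: "`X̲̲_v := Spec K_v`, `Ÿ_v := X̲̲_v`"): `Π_v := G_v`, `aug := id`,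
`Π_Ÿ := ⊤`. [cite: Mochizuki2012, I Ex 3.2 (i)(v) pp.70-72] -/
def trivial : BadLocalGroupDatum G G where
  aug := MonoidHom.id G
  continuous_aug := continuous_id
  isOpenMap_aug := IsOpenMap.id
  Y := ⊤
  map_Y := by
    change (⊤ : Subgroup G).map (MonoidHom.id G) = ⊤
    exact Subgroup.map_id ⊤

/-- The input structure `BadLocalGroupDatum` is inhabited. [cite: Mochizuki2012, I Ex 3.2 (i)(v) pp.70-72] -/
theorem nonempty : Nonempty (BadLocalGroupDatum G G) := ⟨trivial G⟩

/-- For the degenerate datum, `Ÿ_v × A = A` (`⊤ ∩ id⁻¹V = V`). [cite: Mochizuki2012, I Ex 3.2 (v) p.72] -/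
theorem trivial_prodObj (V : CosetCat G) : (trivial G).prodObj V = V :=
  CosetCat.ext (OpenSubgroup.ext fun x =>
    (trivial G).mem_prodSg.trans ⟨fun h => h.2, fun h => ⟨OpenSubgroup.mem_top x, h⟩⟩)

/-- For the degenerate datum, `A` regarded in `D_v` is `A` (`id⁻¹V = V`). [cite: Mochizuki2012, I Ex 3.2 (i) p.70] -/
theorem trivial_incl_obj (V : CosetCat G) : (trivial G).incl.obj V = V :=
  CosetCat.ext (OpenSubgroup.ext fun _ => Iff.rfl)

/-- The inverse `A → Ÿ_v × A` of the second projection, for the degenerate datum. [cite: Mochizuki2012, I Ex 3.2 (v) p.72] -/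
def trivialProdSndInv (V : CosetCat G) : (trivial G).incl.obj V ⟶ (trivial G).prodObj V :=
  CosetCat.homMk ((1 : G) : ((trivial G).prodObj V).carrier) fun u hu => by
    rw [MulAction.Quotient.smul_coe, smul_eq_mul, mul_one]
    exact QuotientGroup.eq.mpr (by
      rw [mul_one, inv_mem_iff]
      exact (trivial G).mem_prodSg.mpr ⟨OpenSubgroup.mem_top u, hu⟩)

/-- **For the degenerate datum the second projection `Ÿ_v × A → A` is an isomorphism.**
[cite: Mochizuki2012, I Ex 3.2 (v) p.72] -/
def prodSndIso (V : CosetCat G) : (trivial G).prodObj V ≅ (trivial G).incl.obj V where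
  hom := (trivial G).prodSnd V
  inv := trivialProdSndInv G V
  hom_inv_id := CosetCat.hom_ext (by
    rw [CosetCat.pt_comp, pt_prodSnd, CosetCat.pt_id]
    exact CosetCat.pt_homMk _ _)
  inv_hom_id := CosetCat.hom_ext (by
    rw [CosetCat.pt_comp, trivialProdSndInv, CosetCat.pt_homMk, CosetCat.pt_id]
    exact (trivial G).pt_prodSnd V)

/-- For the degenerate datum, `(A ↦ Ÿ_v × A) ⋙ ((D_v)_{Ÿ_v} → D_v) ≅ (D⊢_v ⊆ D_v)` naturally (components the second
projections, naturality = `prodMap_snd`). [cite: Mochizuki2012, I Ex 3.2 (v) p.72] -/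
def prodForgetIso : (trivial G).prodFunctor ⋙ Over.forget (trivial G).ydd ≅ (trivial G).incl :=
  NatIso.ofComponents (fun V => prodSndIso G V) fun f => (trivial G).prodMap_snd f

end BadLocalGroupDatum

/-! ### The degenerate tempered side `F̲_v := F÷_v := C_v := C^Θ_v` -/

namespace TemperedThetaInput

variable {p : ℕ} [Fact p.Prime] (d : GaloisValDatum.{0} p) {qroot : intNonzero d.k} (hq : ¬ IsUnit qroot)

/-- `C^Θ_v → D^Θ_v ⊆ (D_v)_{Ÿ_v} → D_v`, the base functor of the degenerate tempered Frobenioid `F̲_v := C^Θ_v`.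
[cite: Mochizuki2012, I Ex 3.2 (v) p.72] -/
abbrev trivialToBase :
    (BadLocalGroupDatum.trivial d.Gal).CTheta d hq ⥤ (BadLocalGroupDatum.trivial d.Gal).Dv :=
  (BadLocalGroupDatum.trivial d.Gal).CThetaBase d hq ⋙ (BadLocalGroupDatum.trivial d.Gal).dThetaIncl ⋙
    Over.forget (BadLocalGroupDatum.trivial d.Gal).ydd

/-- `T_A := (A^Θ, 0)`, the object of `C^Θ_v` of trivial class over `A^Θ = Ÿ_v × A` (degenerate Frobenius-trivial
objects). [cite: Mochizuki2012, I Ex 3.2 (i) p.70] -/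
def trivialTobj (A : (BadLocalGroupDatum.trivial d.Gal).Dv) : (BadLocalGroupDatum.trivial d.Gal).CTheta d hq :=
  ⟨(BadLocalGroupDatum.trivial d.Gal).prodToDTheta.obj A, 1⟩

/-- `T_A` lies over `A` (`Ÿ_v × A = A` for the degenerate datum). [cite: Mochizuki2012, I Ex 3.2 (i) p.70] -/
def trivialTobjBase (A : (BadLocalGroupDatum.trivial d.Gal).Dv) :
    (trivialToBase d hq).obj (trivialTobj d hq A) ≅ A :=
  eqToIso (BadLocalGroupDatum.trivial_prodObj d.Gal A)

/-- `C⊢_v → C_v := C^Θ_v` (the equivalence) lies over `D⊢_v ⊆ D_v` for the degenerate datum: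
`dashThetaEquiv_comp_base`, then `Ÿ_v × A ≅ A` naturally (`prodForgetIso`). [cite: Mochizuki2012, I Ex 3.2 (iv) p.71] -/
def trivialCdashToCBase :
    ((BadLocalGroupDatum.trivial d.Gal).dashThetaEquiv d hq).functor ⋙ 𝟭 _ ⋙ trivialToBase d hq ≅
      d.CdashBase hq ⋙ (BadLocalGroupDatum.trivial d.Gal).incl :=
  NatIso.ofComponents (fun X => BadLocalGroupDatum.prodSndIso d.Gal X.base) fun φ =>
    (BadLocalGroupDatum.trivial d.Gal).prodMap_snd (ModelFrobenioid.baseMap φ)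

/-- **DEGENERATE tempered-side input** over the degenerate group datum: `F̲_v := F÷_v := C_v := C^Θ_v` (the REAL
`p_v`-adic Frobenioid over `D^Θ_v`), `T_A := (A^Θ, 0)`, `𝒪^×(T^÷_{Ÿ_v}) := 1 ∋ Θ̲_v := 1`, `l·ℤ := 1`, constants
trivial, `C⊢_v → C_v :=` the equivalence `C⊢_v ⥲ C^Θ_v`, `C^Θ_v ⊆ F÷_v := 𝟭` (witness only; labelled toy).
[cite: Mochizuki2012, I Ex 3.2 pp.69-73] -/
def trivial : TemperedThetaInput d (BadLocalGroupDatum.trivial d.Gal) hq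
    ((BadLocalGroupDatum.trivial d.Gal).CTheta d hq) ((BadLocalGroupDatum.trivial d.Gal).CTheta d hq)
    ((BadLocalGroupDatum.trivial d.Gal).CTheta d hq) where
  toBase := trivialToBase d hq
  Tobj := trivialTobj d hq
  Tobj_base := trivialTobjBase d hq
  birat := 𝟭 _
  biratBase := trivialToBase d hq
  birat_base := ⟨Functor.leftUnitor _⟩
  unitsTY := ⊥
  unitsTY_comm x hx y hy := by
    rw [Subgroup.mem_bot] at hx hy
    rw [hx, hy]
  theta := 1
  theta_mem := Subgroup.one_mem _
  lZ := ⊥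
  constUnits := 1
  hull := 𝟭 _
  hull_faithful := inferInstance
  CdashToC := ((BadLocalGroupDatum.trivial d.Gal).dashThetaEquiv d hq).functor
  CdashToC_faithful := inferInstance
  CdashToC_base := ⟨trivialCdashToCBase d hq⟩
  CThetaToBirat := 𝟭 _
  CThetaToBirat_faithful := inferInstance
  CThetaToBirat_base := ⟨Functor.leftUnitor _⟩

/-- The tempered-side input structure is inhabited over the degenerate group datum, for every `GaloisValDatum` and every
non-unit `q̲_v`. [cite: Mochizuki2012, I Ex 3.2 pp.69-73] -/
theorem nonempty :
    Nonempty (TemperedThetaInput d (BadLocalGroupDatum.trivial d.Gal) hq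
      ((BadLocalGroupDatum.trivial d.Gal).CTheta d hq) ((BadLocalGroupDatum.trivial d.Gal).CTheta d hq)
      ((BadLocalGroupDatum.trivial d.Gal).CTheta d hq)) :=
  ⟨trivial d hq⟩

end TemperedThetaInput

/-! ### The assembly fires: `K_v := ℚ_p`, `q̲_v := p` -/

namespace BadLocalFrobenioid

variable (p : ℕ) [Fact p.Prime]

/-- `p ∈ 𝒪^▷_{ℚ_p}` as an element of the monoid `intNonzero ℚ_p`. [cite: MochizukiFrdII2008, Ex 1.1 (i) p.7] -/
def pElt : intNonzero (GaloisValDatum.ofPadic p).k := ⟨(p : ℚ_[p]), PadicFrd.p_mem_intNonzero p⟩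

/-- `p` is not a unit of `𝒪^▷_{ℚ_p}` (`v(p) < 1`). [cite: MochizukiFrdII2008, Ex 1.1 (i) p.7] -/
theorem pElt_not_isUnit : ¬ IsUnit (pElt p) := by
  rw [isUnit_intNonzero_iff]
  exact ne_of_lt (PadicFrd.qpFld p).p_lt

/-- **[IUTchI] Ex. 3.2 INHABITED with REAL bases and REAL `C⊢_v ⥲ C^Θ_v` at `K_v := ℚ_p`** (`Ω := ℚ̄_p`, all
valuation inputs discharged by `GaloisValDatum.ofPadic`), `q̲_v := p`, `q_v := p^{2l}`, over the DEGENERATE group datum and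
tempered side of this file: for every prime `p` and every `l`. Witnessed ≠ endorsed. [cite: Mochizuki2012, I Ex 3.2 pp.69-73] -/
def ofKitsPadic (l : ℕ) : BadLocalFrobenioid.{0} l ℚ_[p] :=
  ofKits l (GaloisValDatum.ofPadic p) (BadLocalGroupDatum.trivial _) (pElt p ^ (2 * l)) (pElt p) rfl
    (pElt_not_isUnit p) (TemperedThetaInput.trivial (GaloisValDatum.ofPadic p) (pElt_not_isUnit p))

/-- The bases of the `ℚ_p`-witness are the REAL coset categories of `Gal(ℚ̄_p/ℚ_p)`.
[cite: Mochizuki2012, I Ex 3.2 (i) p.70] -/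
theorem ofKitsPadic_bases (l : ℕ) :
    (ofKitsPadic p l).Dv = CosetCat (GaloisValDatum.ofPadic p).Gal ∧
      (ofKitsPadic p l).Ddash = CosetCat (GaloisValDatum.ofPadic p).Gal :=
  ⟨rfl, rfl⟩

/-- `ofKits` fires: the interface `BadLocalFrobenioid l ℚ_p` has an inhabitant with REAL bases for every `p`, `l`.
[cite: Mochizuki2012, I Ex 3.2 pp.69-73] -/
theorem nonempty_ofKits (l : ℕ) : Nonempty (BadLocalFrobenioid.{0} l ℚ_[p]) := ⟨ofKitsPadic p l⟩

end BadLocalFrobenioid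

end Literature.IUT.HodgeTheaters

end
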